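import Mathlib
import HarnessLib
import Summits.PneNP.PneNP.Theorems.CnfIdealGenLengthRankDefectRepresentationsCutLemma
import Summits.PneNP.PneNP.Theorems.CnfIdealGenLengthRankDefectRepresentationsMergeLowerBound
import Literature.LinearAlgebra.Matrix.JordanCanonicalFormUniqueness

/-!
# The joint cut lemma in coordinates (crux `RankDefectRepresentations` = stmt-PneNP-18923, line `cell-union-merge`, brief §B1,
# registered stub `stub_jointCutLemma` — part 1 of 2)

Rows and columns of a square matrix `G` carry a JOINT colouring `jc : ι → X × Y`.  If every `X`-union commutator
`[1_{jc₁ ∈ A}, G]` has rank `≤ u` and every `Y`-union commutator `[1_{jc₂ ∈ B}, G]` has rank `≤ v`, then every joint-union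
commutator `[1_{jc ∈ C}, G]`, `C ⊆ X × Y` arbitrary, has rank `≤ 144 u + 8 v` (`jointCut_coord`).  Part 2
(`…JointCutLemma`) transfers this to two commuting complete orthogonal systems of idempotent matrices by an adapted basis and
closes the registered stub with `κ = 144`.

Proof.  `rank [1_S, G]` and the cut `rank G|_{S×Sᶜ} + rank G|_{Sᶜ×S}` agree within a factor 2 (`rank_comm_le_cut`,
`cut_le_two_mul_rank_comm`); the MAX-CUT DECOMPOSITION of the tree (`…CutLemma.exists_blockDiagonal_of_maxCut`, p642852) puts `G`
within rank `8u` of an `X`-block-diagonal `G₁`; the joint cut of `G₁` splits over the `X`-blocks into `Y`-cuts of the diagonal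
blocks (`restrict_eq_sum_blocks`), each of which is averaged over all `B ⊆ Y` by the TILING inequality
`cut_{B₀} ≤ 2 (cut_B + cut_{B △ B₀})` (`rank_offDiag_le_tiling`, `pow_mul_cut_le_four_mul_sum`), and for each `B` the block cuts add
up below the cylinder cut of `G₁` (`sum_rank_diagBlocks_le`, from `Literature.LinearAlgebra.Matrix.rank_blockDiagonal'`,
Horn–Johnson 0.9.2), which is `≤ 2v + 32u`.  Bookkeeping: `rank [1_C, G] ≤ 16u + (128u + 8v) = 144u + 8v`.
HONEST FRAMING: elementary linear algebra for the negative lane of the crux (line `cell-union-merge`, T2); nothing here bears on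
P ≠ NP; F-N2 is a FRONTIER formal rung.
-/

set_option linter.dupNamespace false -- `Summit.PneNP.PneNP.…`: summit = sub-problem name (D-0017)

namespace Summit.PneNP.PneNP.Theorems.CnfIdealGenLengthRankDefectRepresentationsJointCutCoord

open Finset Matrix Module
open Summit.PneNP.PneNP.Theorems.CnfIdealGenLengthRankDefectRepresentationsCutLemma
  (rank_padBlock_eq exists_blockDiagonal_of_maxCut)
open Summit.PneNP.PneNP.Theorems.CnfIdealGenLengthRankDefectRepresentationsCutLemmaMaxCut (rank_finsetSum_le)
open Summit.PneNP.PneNP.Theorems.CnfIdealGenLengthRankDefectRepresentationsMergeLowerBound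
  (rank_add_le' rank_neg' rank_sub_le')
variable {K : Type} [Field K]

section Cuts

variable {ι : Type} [Fintype ι] [DecidableEq ι]

/-- `[1_S, M] = M|_{S×Sᶜ} − M|_{Sᶜ×S}` for the 0/1 diagonal matrix `1_S` of a set of coordinates `S`. [folklore] -/
theorem comm_diagonal_eq (S : ι → Prop) [DecidablePred S] (M : Matrix ι ι K) :
    (Matrix.diagonal fun i => if S i then (1 : K) else 0) * M - M * Matrix.diagonal (fun i => if S i then (1 : K) else 0) =
      (Matrix.of fun i j => if S i ∧ ¬ S j then M i j else 0) - Matrix.of fun i j => if ¬ S i ∧ S j then M i j else 0 := by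
  ext i j
  simp only [Matrix.sub_apply, Matrix.diagonal_mul, Matrix.mul_diagonal, Matrix.of_apply]
  by_cases hi : S i <;> by_cases hj : S j <;> simp [hi, hj]

/-- `rank [1_S, M] ≤ rank M|_{S×Sᶜ} + rank M|_{Sᶜ×S}`: the commutator with a coordinate projection is controlled by the cut.
[folklore] -/
theorem rank_comm_le_cut (S : ι → Prop) [DecidablePred S] (M : Matrix ι ι K) :
    ((Matrix.diagonal fun i => if S i then (1 : K) else 0) * M - M * Matrix.diagonal (fun i => if S i then (1 : K) else 0)).rank ≤
      (Matrix.of fun i j => if S i ∧ ¬ S j then M i j else 0).rank +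
        (Matrix.of fun i j => if ¬ S i ∧ S j then M i j else 0).rank := by
  rw [comm_diagonal_eq]; exact rank_sub_le' _ _

/-- The off-diagonal block `M|_{S×Sᶜ}` is `[1_S, M] · 1_{Sᶜ}`. [folklore] -/
theorem offDiag_eq_comm_mul (S : ι → Prop) [DecidablePred S] (M : Matrix ι ι K) :
    (Matrix.of fun i j => if S i ∧ ¬ S j then M i j else 0) =
      ((Matrix.diagonal fun i => if S i then (1 : K) else 0) * M - M * Matrix.diagonal (fun i => if S i then (1 : K) else 0)) *
        Matrix.diagonal (fun i => if ¬ S i then (1 : K) else 0) := by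
  ext i j
  simp only [Matrix.mul_diagonal, Matrix.sub_apply, Matrix.diagonal_mul, Matrix.of_apply]
  by_cases hi : S i <;> by_cases hj : S j <;> simp [hi, hj]

/-- The off-diagonal block `M|_{Sᶜ×S}` is `−1_{Sᶜ} · [1_S, M]`. [folklore] -/
theorem offDiag_eq_mul_comm (S : ι → Prop) [DecidablePred S] (M : Matrix ι ι K) :
    (Matrix.of fun i j => if ¬ S i ∧ S j then M i j else 0) =
      -(Matrix.diagonal (fun i => if ¬ S i then (1 : K) else 0) *
        ((Matrix.diagonal fun i => if S i then (1 : K) else 0) * M - M * Matrix.diagonal (fun i => if S i then (1 : K) else 0))) := by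
  ext i j
  simp only [Matrix.neg_apply, Matrix.mul_sub, Matrix.sub_apply, Matrix.mul_diagonal, Matrix.diagonal_mul, Matrix.of_apply]
  by_cases hi : S i <;> by_cases hj : S j <;> simp [hi, hj]

/-- Both cut blocks have rank at most `rank [1_S, M]`, hence `cut_S(M) ≤ 2 · rank [1_S, M]`. [folklore] -/
theorem cut_le_two_mul_rank_comm (S : ι → Prop) [DecidablePred S] (M : Matrix ι ι K) :
    (Matrix.of fun i j => if S i ∧ ¬ S j then M i j else 0).rank +
        (Matrix.of fun i j => if ¬ S i ∧ S j then M i j else 0).rank ≤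
      2 * ((Matrix.diagonal fun i => if S i then (1 : K) else 0) * M -
        M * Matrix.diagonal (fun i => if S i then (1 : K) else 0)).rank := by
  have h1 := Matrix.rank_mul_le_left
    ((Matrix.diagonal fun i => if S i then (1 : K) else 0) * M - M * Matrix.diagonal (fun i => if S i then (1 : K) else 0))
    (Matrix.diagonal (fun i => if ¬ S i then (1 : K) else 0))
  rw [← offDiag_eq_comm_mul] at h1
  have h2 := Matrix.rank_mul_le_right (Matrix.diagonal (fun i => if ¬ S i then (1 : K) else 0))
    ((Matrix.diagonal fun i => if S i then (1 : K) else 0) * M - M * Matrix.diagonal (fun i => if S i then (1 : K) else 0))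
  rw [← rank_neg', ← offDiag_eq_mul_comm] at h2
  omega

/-- `[D, M] = [D, N] + [D, M − N]`, so `rank [D, M] ≤ rank [D, N] + 2 rank (M − N)`. [folklore] -/
theorem rank_comm_le_of_sub (D M N : Matrix ι ι K) :
    (D * M - M * D).rank ≤ (D * N - N * D).rank + 2 * (M - N).rank := by
  have h : D * M - M * D = (D * N - N * D) + (D * (M - N) - (M - N) * D) := by
    rw [Matrix.mul_sub, Matrix.sub_mul]; abel
  rw [h]
  refine (rank_add_le' _ _).trans ?_
  have h1 := rank_sub_le' (D * (M - N)) ((M - N) * D)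
  have h2 := Matrix.rank_mul_le_right D (M - N)
  have h3 := Matrix.rank_mul_le_left (M - N) D
  omega

/-- `rank [D, M] ≤ rank [D, N] + 2 rank (N − M)`. [folklore] -/
theorem rank_comm_le_of_sub' (D M N : Matrix ι ι K) :
    (D * M - M * D).rank ≤ (D * N - N * D).rank + 2 * (N - M).rank := by
  have h := rank_comm_le_of_sub D M N
  rw [← rank_neg' (M - N), neg_sub] at h
  exact h

/-- A sub-rectangle of a zero-padded rectangle has no larger rank. [folklore] -/
theorem rank_restrict_mono (p q p' q' : ι → Prop) [DecidablePred p] [DecidablePred q] [DecidablePred p'] [DecidablePred q']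
    (M : Matrix ι ι K) (hp : ∀ i, p' i → p i) (hq : ∀ j, q' j → q j) :
    (Matrix.of fun i j => if p' i ∧ q' j then M i j else 0).rank ≤
      (Matrix.of fun i j => if p i ∧ q j then M i j else 0).rank := by
  have h : (Matrix.of fun i j => if p' i ∧ q' j then M i j else 0) =
      Matrix.diagonal (fun i => if p' i then (1 : K) else 0) * (Matrix.of fun i j => if p i ∧ q j then M i j else 0) *
        Matrix.diagonal (fun j => if q' j then (1 : K) else 0) := by
    ext i j
    simp only [Matrix.mul_diagonal, Matrix.diagonal_mul, Matrix.of_apply]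
    by_cases h1 : p' i
    · by_cases h2 : q' j
      · simp [h1, h2, hp i h1, hq j h2]
      · simp [h1, h2]
    · simp [h1]
  rw [h]
  exact (Matrix.rank_mul_le_left _ _).trans (Matrix.rank_mul_le_right _ _)

omit [Fintype ι] [DecidableEq ι] in
/-- A zero-padded rectangle is the transpose of the mirrored rectangle of the transpose. [folklore] -/
theorem offDiag_transpose (p q : ι → Prop) [DecidablePred p] [DecidablePred q] (M : Matrix ι ι K) :
    (Matrix.of fun i j => if p i ∧ q j then M i j else 0) = (Matrix.of fun i j => if q i ∧ p j then Mᵀ i j else 0)ᵀ := by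
  ext i j
  simp only [Matrix.transpose_apply, Matrix.of_apply]
  by_cases h1 : p i <;> by_cases h2 : q j <;> simp [h1, h2]

omit [DecidableEq ι] in
/-- `rank M|_{p×q} = rank Mᵀ|_{q×p}`. [folklore] -/
theorem rank_offDiag_swap (p q : ι → Prop) [DecidablePred p] [DecidablePred q] (M : Matrix ι ι K) :
    (Matrix.of fun i j => if p i ∧ q j then M i j else 0).rank = (Matrix.of fun i j => if q i ∧ p j then Mᵀ i j else 0).rank := by
  rw [offDiag_transpose p q M, Matrix.rank_transpose]

/-- `rank (A + B + C + D) ≤ rank A + rank B + rank C + rank D`. [folklore] -/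
theorem rank_add_four_le {m n : Type} [Fintype m] [Fintype n] (A B C D : Matrix m n K) :
    (A + B + C + D).rank ≤ A.rank + B.rank + C.rank + D.rank :=
  (rank_add_le' _ _).trans (Nat.add_le_add_right ((rank_add_le' _ _).trans (Nat.add_le_add_right (rank_add_le' _ _) _)) _)

variable {Y : Type} [DecidableEq Y]

/-- TILING: for `S = {c ∈ B₀}` the rectangle `M|_{S×Sᶜ}` is covered by four sub-rectangles of the two cut rectangles of `B` and the
two cut rectangles of `B △ B₀`, so `rank M|_{S×Sᶜ} ≤ cut_B(M) + cut_{B △ B₀}(M)`. [folklore] -/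
theorem rank_offDiag_le_tiling (c : ι → Y) (M : Matrix ι ι K) (B₀ B : Finset Y) :
    (Matrix.of fun i j => if c i ∈ B₀ ∧ c j ∉ B₀ then M i j else 0).rank ≤
      ((Matrix.of fun i j => if c i ∈ B ∧ c j ∉ B then M i j else 0).rank +
        (Matrix.of fun i j => if c i ∉ B ∧ c j ∈ B then M i j else 0).rank) +
      ((Matrix.of fun i j => if c i ∈ symmDiff B B₀ ∧ c j ∉ symmDiff B B₀ then M i j else 0).rank +
        (Matrix.of fun i j => if c i ∉ symmDiff B B₀ ∧ c j ∈ symmDiff B B₀ then M i j else 0).rank) := by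
  have hsplit : (Matrix.of fun i j => if c i ∈ B₀ ∧ c j ∉ B₀ then M i j else 0) =
      (Matrix.of fun i j => if (c i ∈ B₀ ∧ c i ∈ B) ∧ (c j ∉ B₀ ∧ c j ∉ B) then M i j else 0) +
      (Matrix.of fun i j => if (c i ∈ B₀ ∧ c i ∉ B) ∧ (c j ∉ B₀ ∧ c j ∈ B) then M i j else 0) +
      (Matrix.of fun i j => if (c i ∈ B₀ ∧ c i ∈ B) ∧ (c j ∉ B₀ ∧ c j ∈ B) then M i j else 0) +
      (Matrix.of fun i j => if (c i ∈ B₀ ∧ c i ∉ B) ∧ (c j ∉ B₀ ∧ c j ∉ B) then M i j else 0) := by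
    ext i j
    simp only [Matrix.add_apply, Matrix.of_apply]
    by_cases h1 : c i ∈ B₀ <;> by_cases h2 : c i ∈ B <;> by_cases h3 : c j ∈ B₀ <;> by_cases h4 : c j ∈ B <;>
      simp [h1, h2, h3, h4]
  have hD : ∀ y, y ∈ symmDiff B B₀ ↔ (y ∈ B ∧ y ∉ B₀) ∨ (y ∈ B₀ ∧ y ∉ B) := fun y => Finset.mem_symmDiff
  have e1 := rank_restrict_mono (fun i => c i ∈ B) (fun j => c j ∉ B)
    (fun i => c i ∈ B₀ ∧ c i ∈ B) (fun j => c j ∉ B₀ ∧ c j ∉ B) M (fun i h => h.2) (fun j h => h.2)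
  have e2 := rank_restrict_mono (fun i => c i ∉ B) (fun j => c j ∈ B)
    (fun i => c i ∈ B₀ ∧ c i ∉ B) (fun j => c j ∉ B₀ ∧ c j ∈ B) M (fun i h => h.2) (fun j h => h.2)
  have e3 := rank_restrict_mono (fun i => c i ∉ symmDiff B B₀) (fun j => c j ∈ symmDiff B B₀)
    (fun i => c i ∈ B₀ ∧ c i ∈ B) (fun j => c j ∉ B₀ ∧ c j ∈ B) M
    (fun i h => by rw [hD]; tauto) (fun j h => by rw [hD]; tauto)
  have e4 := rank_restrict_mono (fun i => c i ∈ symmDiff B B₀) (fun j => c j ∉ symmDiff B B₀)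
    (fun i => c i ∈ B₀ ∧ c i ∉ B) (fun j => c j ∉ B₀ ∧ c j ∉ B) M
    (fun i h => by rw [hD]; tauto) (fun j h => by rw [hD]; tauto)
  rw [hsplit]
  refine (rank_add_four_le _ _ _ _).trans ?_
  omega

/-- Re-indexing a sum over all colour sets by the involution `B ↦ B △ B₀`. [folklore] -/
theorem sum_symmDiff_right {Y : Type} [Fintype Y] [DecidableEq Y] {N : Type} [AddCommMonoid N] (f : Finset Y → N)
    (B₀ : Finset Y) : ∑ B : Finset Y, f (symmDiff B B₀) = ∑ B : Finset Y, f B :=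
  Fintype.sum_equiv ⟨fun B => symmDiff B B₀, fun B => symmDiff B B₀,
      fun B => symmDiff_symmDiff_cancel_right B₀ B, fun B => symmDiff_symmDiff_cancel_right B₀ B⟩ _ _ (fun _ => rfl)

/-- AVERAGING: every bipartition cut is at most four times the average bipartition cut,
`2^{#Y} · cut_{B₀}(M) ≤ 4 · Σ_{B ⊆ Y} cut_B(M)` (sum the tiling inequality over `B` and re-index `B ↦ B △ B₀`). [folklore] -/
theorem pow_mul_cut_le_four_mul_sum [Fintype Y] (c : ι → Y) (M : Matrix ι ι K) (B₀ : Finset Y) :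
    2 ^ Fintype.card Y * ((Matrix.of fun i j => if c i ∈ B₀ ∧ c j ∉ B₀ then M i j else 0).rank +
        (Matrix.of fun i j => if c i ∉ B₀ ∧ c j ∈ B₀ then M i j else 0).rank) ≤
      4 * ∑ B : Finset Y, ((Matrix.of fun i j => if c i ∈ B ∧ c j ∉ B then M i j else 0).rank +
        (Matrix.of fun i j => if c i ∉ B ∧ c j ∈ B then M i j else 0).rank) := by
  have key : ∀ B : Finset Y,
      (Matrix.of fun i j => if c i ∈ B₀ ∧ c j ∉ B₀ then M i j else 0).rank +
        (Matrix.of fun i j => if c i ∉ B₀ ∧ c j ∈ B₀ then M i j else 0).rank ≤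
      2 * (((Matrix.of fun i j => if c i ∈ B ∧ c j ∉ B then M i j else 0).rank +
        (Matrix.of fun i j => if c i ∉ B ∧ c j ∈ B then M i j else 0).rank) +
        ((Matrix.of fun i j => if c i ∈ symmDiff B B₀ ∧ c j ∉ symmDiff B B₀ then M i j else 0).rank +
        (Matrix.of fun i j => if c i ∉ symmDiff B B₀ ∧ c j ∈ symmDiff B B₀ then M i j else 0).rank)) := by
    intro B
    have h1 := rank_offDiag_le_tiling c M B₀ B
    have h2 := rank_offDiag_le_tiling c Mᵀ B₀ B
    have s0 := rank_offDiag_swap (fun i => c i ∉ B₀) (fun j => c j ∈ B₀) M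
    have s1 := rank_offDiag_swap (fun i => c i ∉ B) (fun j => c j ∈ B) M
    have s2 := rank_offDiag_swap (fun i => c i ∈ B) (fun j => c j ∉ B) M
    have s3 := rank_offDiag_swap (fun i => c i ∉ symmDiff B B₀) (fun j => c j ∈ symmDiff B B₀) M
    have s4 := rank_offDiag_swap (fun i => c i ∈ symmDiff B B₀) (fun j => c j ∉ symmDiff B B₀) M
    omega
  calc 2 ^ Fintype.card Y * ((Matrix.of fun i j => if c i ∈ B₀ ∧ c j ∉ B₀ then M i j else 0).rank +
        (Matrix.of fun i j => if c i ∉ B₀ ∧ c j ∈ B₀ then M i j else 0).rank)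
      = ∑ B : Finset Y, ((Matrix.of fun i j => if c i ∈ B₀ ∧ c j ∉ B₀ then M i j else 0).rank +
        (Matrix.of fun i j => if c i ∉ B₀ ∧ c j ∈ B₀ then M i j else 0).rank) := by
          rw [Finset.sum_const, Finset.card_univ, Fintype.card_finset, smul_eq_mul]
    _ ≤ ∑ B : Finset Y, 2 * (((Matrix.of fun i j => if c i ∈ B ∧ c j ∉ B then M i j else 0).rank +
        (Matrix.of fun i j => if c i ∉ B ∧ c j ∈ B then M i j else 0).rank) +
        ((Matrix.of fun i j => if c i ∈ symmDiff B B₀ ∧ c j ∉ symmDiff B B₀ then M i j else 0).rank +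
        (Matrix.of fun i j => if c i ∉ symmDiff B B₀ ∧ c j ∈ symmDiff B B₀ then M i j else 0).rank)) :=
          Finset.sum_le_sum fun B _ => key B
    _ = 4 * ∑ B : Finset Y, ((Matrix.of fun i j => if c i ∈ B ∧ c j ∉ B then M i j else 0).rank +
        (Matrix.of fun i j => if c i ∉ B ∧ c j ∈ B then M i j else 0).rank) := by
          rw [← Finset.mul_sum, Finset.sum_add_distrib,
            sum_symmDiff_right (fun B => (Matrix.of fun i j => if c i ∈ B ∧ c j ∉ B then M i j else 0).rank +
              (Matrix.of fun i j => if c i ∉ B ∧ c j ∈ B then M i j else 0).rank) B₀]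
          ring

variable {X : Type} [Fintype X] [DecidableEq X]

/-- The diagonal blocks of an `X`-block-diagonal matrix have total rank at most (in fact equal to) its rank: re-index along the
fibres of the colouring to a `blockDiagonal'` and use `Literature.LinearAlgebra.Matrix.rank_blockDiagonal'` (Horn–Johnson 0.9.2).
[folklore] -/
theorem sum_rank_diagBlocks_le (c₁ : ι → X) (N : Matrix ι ι K) (hN : ∀ i j, c₁ i ≠ c₁ j → N i j = 0) :
    ∑ x, (Matrix.of fun i j => if c₁ i = x ∧ c₁ j = x then N i j else 0).rank ≤ N.rank := by
  -- adapted from Summits/HodgeConjecture/.../HodgeLocusCensusUnitColumnRankD4Levels.lean (`rank_eq_sum_rank_fiber`)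
  have hre : Matrix.reindex (Equiv.sigmaFiberEquiv c₁).symm (Equiv.sigmaFiberEquiv c₁).symm N =
      blockDiagonal' (fun x => N.submatrix (Subtype.val : {i // c₁ i = x} → ι) (Subtype.val : {j // c₁ j = x} → ι)) := by
    ext ⟨x, i⟩ ⟨x', j⟩
    simp only [Matrix.reindex_apply, Equiv.symm_symm, Matrix.submatrix_apply, Equiv.sigmaFiberEquiv_apply]
    by_cases hxx : x = x'
    · subst hxx
      rw [blockDiagonal'_apply_eq, Matrix.submatrix_apply]
    · rw [blockDiagonal'_apply_ne _ _ _ hxx]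
      exact hN i.1 j.1 (fun hh => hxx (i.2.symm.trans (hh.trans j.2)))
  have h : N.rank = ∑ x, (N.submatrix (Subtype.val : {i // c₁ i = x} → ι) (Subtype.val : {j // c₁ j = x} → ι)).rank := by
    rw [← Matrix.rank_reindex (Equiv.sigmaFiberEquiv c₁).symm (Equiv.sigmaFiberEquiv c₁).symm N, hre,
      Literature.LinearAlgebra.Matrix.rank_blockDiagonal']
  rw [h]
  exact le_of_eq (Finset.sum_congr rfl fun x _ => rank_padBlock_eq c₁ c₁ N (· = x) (· = x))

omit [Fintype ι] [DecidableEq ι] [DecidableEq Y] in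
/-- For an `X`-block-diagonal `N` and a joint colouring `jc : ι → X × Y`, a rectangle cut out by predicates of the joint colour is
the sum over the blocks `x` of the rectangles of the diagonal block `N^x` cut out by the fibre predicates at `x`. [folklore] -/
theorem restrict_eq_sum_blocks (jc : ι → X × Y) (N : Matrix ι ι K) (hN : ∀ i j, (jc i).1 ≠ (jc j).1 → N i j = 0)
    (p q : X × Y → Prop) [DecidablePred p] [DecidablePred q] :
    (Matrix.of fun i j => if p (jc i) ∧ q (jc j) then N i j else 0) =
      ∑ x, Matrix.of fun i j => if p (x, (jc i).2) ∧ q (x, (jc j).2) then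
        (Matrix.of fun i' j' => if (jc i').1 = x ∧ (jc j').1 = x then N i' j' else 0) i j else 0 := by
  ext i j
  rw [Matrix.sum_apply]
  simp only [Matrix.of_apply]
  by_cases hij : (jc i).1 = (jc j).1
  · rw [Finset.sum_eq_single (jc i).1]
    · have ei : ((jc i).1, (jc i).2) = jc i := Prod.mk.eta
      have ej : ((jc i).1, (jc j).2) = jc j := by rw [hij]
      rw [ei, ej]
      by_cases hpq : p (jc i) ∧ q (jc j) <;> simp [hpq, hij]
    · intro x _ hx
      have hx' : ¬ ((jc i).1 = x ∧ (jc j).1 = x) := fun h => hx h.1.symm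
      simp [hx']
    · intro h; exact absurd (Finset.mem_univ _) h
  · rw [hN i j hij]
    simp

/-- **The joint cut lemma in coordinates.**  Rows and columns of `G` carry a joint colouring `jc : ι → X × Y`; if every
`X`-union commutator `[1_{jc₁ ∈ A}, G]` has rank `≤ u` and every `Y`-union commutator `[1_{jc₂ ∈ B}, G]` has rank `≤ v`, then
for every `C ⊆ X × Y` the joint-union commutator `[1_{jc ∈ C}, G]` has rank `≤ 144 u + 8 v`. [folklore] -/
theorem jointCut_coord [Fintype Y] (jc : ι → X × Y) (G : Matrix ι ι K) (u v : ℕ)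
    (hu : ∀ A : Finset X, ((Matrix.diagonal fun i => if (jc i).1 ∈ A then (1 : K) else 0) * G -
        G * Matrix.diagonal (fun i => if (jc i).1 ∈ A then (1 : K) else 0)).rank ≤ u)
    (hv : ∀ B : Finset Y, ((Matrix.diagonal fun i => if (jc i).2 ∈ B then (1 : K) else 0) * G -
        G * Matrix.diagonal (fun i => if (jc i).2 ∈ B then (1 : K) else 0)).rank ≤ v)
    (C : Finset (X × Y)) :
    ((Matrix.diagonal fun i => if jc i ∈ C then (1 : K) else 0) * G -
        G * Matrix.diagonal (fun i => if jc i ∈ C then (1 : K) else 0)).rank ≤ 144 * u + 8 * v := by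
  -- (1) `X`-block-diagonalise `G` by the max-cut decomposition
  obtain ⟨Bs, -, hBs⟩ := Finset.exists_max_image (univ : Finset (Finset X))
    (fun B' => (Matrix.of fun i j => if (jc i).1 ∈ B' ∧ (jc j).1 ∉ B' then G i j else 0).rank +
      (Matrix.of fun i j => if (jc i).1 ∉ B' ∧ (jc j).1 ∈ B' then G i j else 0).rank) univ_nonempty
  obtain ⟨G₁, hG₁, hGG₁⟩ := exists_blockDiagonal_of_maxCut (fun i => (jc i).1) (fun j => (jc j).1) G Bs
    (fun B' => hBs B' (mem_univ _))
  have hμ : (Matrix.of fun i j => if (jc i).1 ∈ Bs ∧ (jc j).1 ∉ Bs then G i j else 0).rank +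
      (Matrix.of fun i j => if (jc i).1 ∉ Bs ∧ (jc j).1 ∈ Bs then G i j else 0).rank ≤ 2 * u :=
    (cut_le_two_mul_rank_comm (fun i => (jc i).1 ∈ Bs) G).trans (Nat.mul_le_mul_left 2 (hu Bs))
  have hdist : (G - G₁).rank ≤ 8 * u := hGG₁.trans (by omega)
  -- (2) every `Y`-cylinder cut of `G₁` is `≤ 2 v + 32 u`
  have hcyl : ∀ B : Finset Y, (Matrix.of fun i j => if (jc i).2 ∈ B ∧ (jc j).2 ∉ B then G₁ i j else 0).rank +
      (Matrix.of fun i j => if (jc i).2 ∉ B ∧ (jc j).2 ∈ B then G₁ i j else 0).rank ≤ 2 * v + 32 * u := by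
    intro B
    have h1 := cut_le_two_mul_rank_comm (fun i => (jc i).2 ∈ B) G₁
    have h2 := rank_comm_le_of_sub' (Matrix.diagonal fun i => if (jc i).2 ∈ B then (1 : K) else 0) G₁ G
    have h3 := hv B
    omega
  -- (3) the `Y`-cuts of the diagonal blocks `G₁^x` add up, for each `B`, below the cylinder cut
  have hblocks : ∀ B : Finset Y, ∑ x : X, ((Matrix.of fun i j => if (jc i).2 ∈ B ∧ (jc j).2 ∉ B then
      (Matrix.of fun i' j' => if (jc i').1 = x ∧ (jc j').1 = x then G₁ i' j' else 0) i j else 0).rank +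
      (Matrix.of fun i j => if (jc i).2 ∉ B ∧ (jc j).2 ∈ B then
      (Matrix.of fun i' j' => if (jc i').1 = x ∧ (jc j').1 = x then G₁ i' j' else 0) i j else 0).rank) ≤
      2 * v + 32 * u := by
    intro B
    rw [Finset.sum_add_distrib]
    refine le_trans (Nat.add_le_add ?_ ?_) (hcyl B)
    · have hN : ∀ i j, (jc i).1 ≠ (jc j).1 →
          (Matrix.of fun i j => if (jc i).2 ∈ B ∧ (jc j).2 ∉ B then G₁ i j else 0) i j = 0 := by
        intro i j hij; simp [hG₁ i j hij]
      refine le_of_eq_of_le (Finset.sum_congr rfl fun x _ => ?_) (sum_rank_diagBlocks_le (fun i => (jc i).1) _ hN)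
      congr 1
      ext i j
      simp only [Matrix.of_apply]
      by_cases h1 : (jc i).1 = x <;> by_cases h2 : (jc j).1 = x <;> simp [h1, h2]
    · have hN : ∀ i j, (jc i).1 ≠ (jc j).1 →
          (Matrix.of fun i j => if (jc i).2 ∉ B ∧ (jc j).2 ∈ B then G₁ i j else 0) i j = 0 := by
        intro i j hij; simp [hG₁ i j hij]
      refine le_of_eq_of_le (Finset.sum_congr rfl fun x _ => ?_) (sum_rank_diagBlocks_le (fun i => (jc i).1) _ hN)
      congr 1
      ext i j
      simp only [Matrix.of_apply]
      by_cases h1 : (jc i).1 = x <;> by_cases h2 : (jc j).1 = x <;> simp [h1, h2]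
  -- (4) averaging inside each block, then summing over the blocks
  have havg : 2 ^ Fintype.card Y * ∑ x : X,
      ((Matrix.of fun i j => if (jc i).2 ∈ (univ.filter fun y => (x, y) ∈ C) ∧ (jc j).2 ∉ (univ.filter fun y => (x, y) ∈ C) then
        (Matrix.of fun i' j' => if (jc i').1 = x ∧ (jc j').1 = x then G₁ i' j' else 0) i j else 0).rank +
      (Matrix.of fun i j => if (jc i).2 ∉ (univ.filter fun y => (x, y) ∈ C) ∧ (jc j).2 ∈ (univ.filter fun y => (x, y) ∈ C) then
        (Matrix.of fun i' j' => if (jc i').1 = x ∧ (jc j').1 = x then G₁ i' j' else 0) i j else 0).rank) ≤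
      2 ^ Fintype.card Y * (8 * v + 128 * u) := by
    rw [Finset.mul_sum]
    calc ∑ x : X, 2 ^ Fintype.card Y *
          ((Matrix.of fun i j => if (jc i).2 ∈ (univ.filter fun y => (x, y) ∈ C) ∧ (jc j).2 ∉ (univ.filter fun y => (x, y) ∈ C) then
            (Matrix.of fun i' j' => if (jc i').1 = x ∧ (jc j').1 = x then G₁ i' j' else 0) i j else 0).rank +
          (Matrix.of fun i j => if (jc i).2 ∉ (univ.filter fun y => (x, y) ∈ C) ∧ (jc j).2 ∈ (univ.filter fun y => (x, y) ∈ C) then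
            (Matrix.of fun i' j' => if (jc i').1 = x ∧ (jc j').1 = x then G₁ i' j' else 0) i j else 0).rank)
        ≤ ∑ x : X, 4 * ∑ B : Finset Y, ((Matrix.of fun i j => if (jc i).2 ∈ B ∧ (jc j).2 ∉ B then
            (Matrix.of fun i' j' => if (jc i').1 = x ∧ (jc j').1 = x then G₁ i' j' else 0) i j else 0).rank +
          (Matrix.of fun i j => if (jc i).2 ∉ B ∧ (jc j).2 ∈ B then
            (Matrix.of fun i' j' => if (jc i').1 = x ∧ (jc j').1 = x then G₁ i' j' else 0) i j else 0).rank) :=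
          Finset.sum_le_sum fun x _ => pow_mul_cut_le_four_mul_sum (fun i => (jc i).2) _ _
      _ = 4 * ∑ B : Finset Y, ∑ x : X, ((Matrix.of fun i j => if (jc i).2 ∈ B ∧ (jc j).2 ∉ B then
            (Matrix.of fun i' j' => if (jc i').1 = x ∧ (jc j').1 = x then G₁ i' j' else 0) i j else 0).rank +
          (Matrix.of fun i j => if (jc i).2 ∉ B ∧ (jc j).2 ∈ B then
            (Matrix.of fun i' j' => if (jc i').1 = x ∧ (jc j').1 = x then G₁ i' j' else 0) i j else 0).rank) := by
          rw [← Finset.mul_sum, Finset.sum_comm]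
      _ ≤ 4 * ∑ _B : Finset Y, (2 * v + 32 * u) := Nat.mul_le_mul_left 4 (Finset.sum_le_sum fun B _ => hblocks B)
      _ = 2 ^ Fintype.card Y * (8 * v + 128 * u) := by
          rw [Finset.sum_const, Finset.card_univ, Fintype.card_finset, smul_eq_mul]; ring
  have hsum := Nat.le_of_mul_le_mul_left havg (by positivity)
  -- (5) the joint cut of `G₁` splits over the blocks
  have hcutC : (Matrix.of fun i j => if jc i ∈ C ∧ jc j ∉ C then G₁ i j else 0).rank +
      (Matrix.of fun i j => if jc i ∉ C ∧ jc j ∈ C then G₁ i j else 0).rank ≤ ∑ x : X,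
      ((Matrix.of fun i j => if (jc i).2 ∈ (univ.filter fun y => (x, y) ∈ C) ∧ (jc j).2 ∉ (univ.filter fun y => (x, y) ∈ C) then
        (Matrix.of fun i' j' => if (jc i').1 = x ∧ (jc j').1 = x then G₁ i' j' else 0) i j else 0).rank +
      (Matrix.of fun i j => if (jc i).2 ∉ (univ.filter fun y => (x, y) ∈ C) ∧ (jc j).2 ∈ (univ.filter fun y => (x, y) ∈ C) then
        (Matrix.of fun i' j' => if (jc i').1 = x ∧ (jc j').1 = x then G₁ i' j' else 0) i j else 0).rank) := by
    rw [restrict_eq_sum_blocks jc G₁ hG₁ (· ∈ C) (· ∉ C), restrict_eq_sum_blocks jc G₁ hG₁ (· ∉ C) (· ∈ C),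
      Finset.sum_add_distrib]
    refine Nat.add_le_add ((rank_finsetSum_le _ _).trans (le_of_eq (Finset.sum_congr rfl fun x _ => ?_)))
      ((rank_finsetSum_le _ _).trans (le_of_eq (Finset.sum_congr rfl fun x _ => ?_)))
    · congr 1
      ext i j
      simp only [Matrix.of_apply, Finset.mem_filter, Finset.mem_univ, true_and]
    · congr 1
      ext i j
      simp only [Matrix.of_apply, Finset.mem_filter, Finset.mem_univ, true_and]
  -- (6) bookkeeping
  have hfin := rank_comm_le_of_sub (Matrix.diagonal fun i => if jc i ∈ C then (1 : K) else 0) G G₁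
  have hcomm := rank_comm_le_cut (fun i => jc i ∈ C) G₁
  omega

end Cuts

end Summit.PneNP.PneNP.Theorems.CnfIdealGenLengthRankDefectRepresentationsJointCutCoord
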